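import Mathlib
import Summits.Ventures.PercRepro2.Defs
import Summits.Ventures.PercRepro2.Independence
import Summits.Ventures.PercRepro2.Harris
import Summits.Ventures.PercRepro2.Graph
import Summits.Ventures.PercRepro2.Exploration
import Summits.Ventures.PercRepro2.Events
import Summits.Ventures.PercRepro2.FourFunctions
import Summits.Ventures.PercRepro2.Induced
import Summits.Ventures.PercRepro2.Frontier
import Summits.Ventures.PercRepro2.ObsIndependence
import Summits.Ventures.PercRepro2.BHK
import Summits.Ventures.PercRepro2.BHKEvents
import Summits.Ventures.PercRepro2.SideAgreement
import Summits.Ventures.PercRepro2.VdBKahn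
import Summits.Ventures.PercRepro2.BHKAvoid
import Summits.Ventures.PercRepro2.R2PrimeThreeReduction
import Summits.Ventures.PercRepro2.YBridge
import Summits.Ventures.PercRepro2.Yu1Functionals
import Summits.Ventures.PercRepro2.Yu1Events
import Summits.Ventures.PercRepro2.Yu1
import Summits.Ventures.PercRepro2.LBSplit
import Summits.Ventures.PercRepro2.YDelta
import Summits.Ventures.PercRepro2.SD
import Summits.Ventures.PercRepro2.Threshold
import Summits.Ventures.PercRepro2.Lambda
import Summits.Ventures.PercRepro2.LambdaTau
import Summits.Ventures.PercRepro2.LambdaSlack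
import Summits.Ventures.PercRepro2.HF2
import Summits.Ventures.PercRepro2.Yu2
import Summits.Ventures.PercRepro2.N0
import Summits.Ventures.PercRepro2.Y
import Summits.Ventures.PercRepro2.YDeltaTools
import Summits.Ventures.PercRepro2.ZDelta
import Summits.Ventures.PercRepro2.ZExpand
import Summits.Ventures.PercRepro2.ISplit
import Summits.Ventures.PercRepro2.MRl
import Summits.Ventures.PercRepro2.ZOloc
import Summits.Ventures.PercRepro2.SideBridge
import Summits.Ventures.PercRepro2.HCov
import Summits.Ventures.PercRepro2.HCovFns
import Summits.Ventures.PercRepro2.HCovSwap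
import Summits.Ventures.PercRepro2.BasePrime
import Summits.Ventures.PercRepro2.PendantRoot
import Summits.Ventures.PercRepro2.PendantO
import Summits.Ventures.PercRepro2.PendantB
import Summits.Ventures.PercRepro2.PendantBRow
import Summits.Ventures.PercRepro2.ChordBase
import Summits.Ventures.PercRepro2.CCTRootEdge
import Summits.Ventures.PercRepro2.EdmD
import Summits.Ventures.PercRepro2.PendantEdm

/-!
# 2′EDM/D at the leaf edge of a pendant `a₃` attached to `b` (blind cell PercRepro2, p1 g7;
completes typer-1's `PendantEdm` (root / `o` attachments) with the `b` attachment, via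
`PendantBRow`; paper: `P1-PENDANTB.md` §4)

At the leaf edge `f` (weight `q`) the row reads `(1 − q)·R(0)·D_q²·P ≤ R(q)·P²·P` with
`D_q = P − q(bL + bH)`, `R(q)` the cleared pendant-at-`b` quadratic. From the Bernstein form
(`pendantB_bernstein`): `P·R(q) = (1 − q)·T₀·D_q + q·S` with `S ≥ 0` a nonnegative combination of
the four BHK slacks, and `P ≥ D_q ≥ 0` finishes.
-/

namespace Summit.Ventures.PercRepro2

open UnionCluster CovForm PendantRoot

namespace PendantEdm

variable {V : Type*} {E : Type*} [Fintype E] [DecidableEq E] {R : Type*} [Field R]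
  [LinearOrder R] [IsStrictOrderedRing R]

section B

variable [Fintype V] [DecidableEq V] (p : E → R) (ends : E → Sym2 V)

/-- **2′EDM/D at the leaf edge, `a₃` a leaf at `b`.** -/
theorem edmD_pendant_b (hp : IsProbVec p) {f : E} {a₃ b : V} (hf : ends f = s(a₃, b))
    (hleaf : ∀ e, a₃ ∈ ends e → e = f) (h3b : a₃ ≠ b) {o a₁ a₂ : V} (h31 : a₃ ≠ a₁)
    (h32 : a₃ ≠ a₂) (ho : o ≠ a₃) : EdmRow.EdmD p ends f o a₁ a₂ a₃ b := by
  unfold EdmRow.EdmD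
  have hG := PendantB.Gc_pendant_b p ends hf hleaf h3b h31 h32 ho
  have hG₀ := PendantB.Gc_pendant_b (Function.update p f 0) ends hf hleaf h3b h31 h32 ho
  have hD := PendantO.prob_PD_o p hf hleaf h3b h31 h32
  have hD₀ := PendantO.prob_PD_o (Function.update p f 0) hf hleaf h3b h31 h32
  have hQfree : Free f (avoidAll ends a₂ {a₁}) := PendantO.free_Q hf hleaf h3b h31 h32
  have hb : b ≠ a₃ := Ne.symm h3b
  have c₁o := free_connEvent hf hleaf h3b (Ne.symm h31) ho
  have c₂o := free_connEvent hf hleaf h3b (Ne.symm h32) ho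
  have c₁b := free_connEvent hf hleaf h3b (Ne.symm h31) hb
  have c₂b := free_connEvent hf hleaf h3b (Ne.symm h32) hb
  simp only [Function.update_self] at hG₀ hD₀
  simp only [prob_update_of_free p hQfree, prob_update_of_free p (hQfree.inter c₁o),
    prob_update_of_free p (hQfree.inter c₂o), prob_update_of_free p (hQfree.inter c₁b),
    prob_update_of_free p (hQfree.inter c₂b), prob_update_of_free p (hQfree.inter (c₁o.inter c₁b)),
    prob_update_of_free p (hQfree.inter (c₂o.inter c₂b)),
    prob_update_of_free p (hQfree.inter (c₂o.inter c₁b)),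
    prob_update_of_free p (hQfree.inter (c₁o.inter c₂b))] at hG₀ hD₀
  rw [hG, hG₀, hD, hD₀, prob_update_of_free p hQfree]
  -- the masses
  have hq0 := hp.nonneg f
  have h1q : 0 ≤ 1 - p f := sub_nonneg.2 (hp.le_one f)
  have hP := prob_nonneg hp (avoidAll ends a₂ {a₁})
  have hbL := prob_nonneg hp (avoidAll ends a₂ {a₁} ∩ connEvent ends a₁ b)
  have hbH := prob_nonneg hp (avoidAll ends a₂ {a₁} ∩ connEvent ends a₂ b)
  have hsum := PendantB.bL_add_bH_le p ends hp a₁ a₂ b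
  have hZL := PendantB.ZL_nonneg p ends hp o a₁ a₂ b
  have hZH := PendantB.ZH_nonneg p ends hp o a₁ a₂ b
  have hYL := PendantB.YL_nonneg p ends hp o a₁ a₂ b
  have hYH := PendantB.YH_nonneg p ends hp o a₁ a₂ b
  set q := p f with hq
  set P := prob p (avoidAll ends a₂ {a₁}) with hPdef
  set bL := prob p (avoidAll ends a₂ {a₁} ∩ connEvent ends a₁ b) with hbLdef
  set bH := prob p (avoidAll ends a₂ {a₁} ∩ connEvent ends a₂ b) with hbHdef
  set oL := prob p (avoidAll ends a₂ {a₁} ∩ connEvent ends a₁ o) with hoLdef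
  set oH := prob p (avoidAll ends a₂ {a₁} ∩ connEvent ends a₂ o) with hoHdef
  set A := prob p (avoidAll ends a₂ {a₁} ∩ (connEvent ends a₁ o ∩ connEvent ends a₁ b)) with hAdef
  set B := prob p (avoidAll ends a₂ {a₁} ∩ (connEvent ends a₂ o ∩ connEvent ends a₂ b)) with hBdef
  set C := prob p (avoidAll ends a₂ {a₁} ∩ (connEvent ends a₂ o ∩ connEvent ends a₁ b)) with hCdef
  set Dd := prob p (avoidAll ends a₂ {a₁} ∩ (connEvent ends a₁ o ∩ connEvent ends a₂ b)) with hDddef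
  -- the four slacks
  set ZL := oL * bH - P * Dd with hZLdef
  set ZH := oH * bL - P * C with hZHdef
  set YL := bH * (oL - A - Dd) - (P - bL - bH) * Dd with hYLdef
  set YH := bL * (oH - B - C) - (P - bL - bH) * C with hYHdef
  have hZL' : 0 ≤ ZL := by rw [hZLdef]; linarith
  have hZH' : 0 ≤ ZH := by rw [hZHdef]; linarith
  have hYL' : 0 ≤ YL := by rw [hYLdef]; linarith
  have hYH' : 0 ≤ YH := by rw [hYHdef]; linarith
  have hD : 0 ≤ P - bL - bH := by linarith
  -- `R(q)` and `T₀` as polynomials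
  set Rq := (P * (A + B - C - Dd) - (bL - bH) * (oL - oH)) * (P - q * (bL + bH)) -
      (1 - q) * (P ^ 2 * (A + B + C + Dd) - P * (oL + oH) * (bL + bH)) +
      q * ((oL + oH) - q * (A + B + C + Dd)) * (P * (bL + bH) - (bL - bH) ^ 2) -
      q * (P - q * (bL + bH)) * (P * (A + B + C + Dd) - (bL - bH) * ((A + C) - (Dd + B))) with hRq
  set T0 := 2 * P * (ZL + ZH) with hT0
  set Dq := P - q * bL - q * bH with hDq
  set S := (1 - q) * (2 * P * (2 * bL * ZL + 2 * bH * ZH + P * (YL + YH))) +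
      q * P * (2 * ((2 * bL + (P - bL - bH)) * YL + (2 * bH + (P - bL - bH)) * YH)) with hS
  have hS0 : 0 ≤ S := by
    rw [hS]
    have hmL : 0 ≤ 2 * bL + (P - bL - bH) := by linarith
    have hmH : 0 ≤ 2 * bH + (P - bL - bH) := by linarith
    have t1 : 0 ≤ 2 * P * (2 * bL * ZL + 2 * bH * ZH + P * (YL + YH)) :=
      mul_nonneg (mul_nonneg (by norm_num) hP)
        (add_nonneg (add_nonneg (mul_nonneg (mul_nonneg (by norm_num) hbL) hZL')
          (mul_nonneg (mul_nonneg (by norm_num) hbH) hZH')) (mul_nonneg hP (add_nonneg hYL' hYH')))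
    have t2 : 0 ≤ q * P * (2 * ((2 * bL + (P - bL - bH)) * YL + (2 * bH + (P - bL - bH)) * YH)) :=
      mul_nonneg (mul_nonneg hq0 hP)
        (mul_nonneg (by norm_num) (add_nonneg (mul_nonneg hmL hYL') (mul_nonneg hmH hYH')))
    exact add_nonneg (mul_nonneg h1q t1) t2
  -- the key identity `P · R(q) = (1 − q) T₀ D_q + q S`
  have key : P * Rq = (1 - q) * T0 * Dq + q * S := by
    rw [hRq, hT0, hDq, hS, hZLdef, hZHdef, hYLdef, hYHdef]; ring
  have hqsum : q * bL + q * bH ≤ bL + bH := by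
    have h := mul_le_of_le_one_left (add_nonneg hbL hbH) (hp.le_one f)
    calc q * bL + q * bH = q * (bL + bH) := by ring
      _ ≤ bL + bH := h
  have hDq0 : 0 ≤ Dq := by rw [hDq]; linarith
  have hqbL := mul_nonneg hq0 hbL
  have hqbH := mul_nonneg hq0 hbH
  have hDqP : Dq ≤ P := by rw [hDq]; linarith
  have hT00 : 0 ≤ T0 := by rw [hT0]; exact mul_nonneg (mul_nonneg (by norm_num) hP) (add_nonneg hZL' hZH')
  -- the goal, in the `set` variables: `(1 − q) · R(0) · Dq² · P ≤ Rq · P² · P`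
  have hR0 : (P * (A + B - C - Dd) - (bL - bH) * (oL - oH)) * (P - 0 * (bL + bH)) -
      (1 - 0) * (P ^ 2 * (A + B + C + Dd) - P * (oL + oH) * (bL + bH)) +
      0 * ((oL + oH) - 0 * (A + B + C + Dd)) * (P * (bL + bH) - (bL - bH) ^ 2) -
      0 * (P - 0 * (bL + bH)) * (P * (A + B + C + Dd) - (bL - bH) * ((A + C) - (Dd + B))) = T0 := by
    rw [hT0, hZLdef, hZHdef]; ring
  have hmain : (1 - q) * T0 * Dq ^ 2 * P ≤ Rq * P ^ 2 * P := by
    have e1 : (1 - q) * T0 * Dq ^ 2 * P = ((1 - q) * T0 * Dq) * (Dq * P) := by ring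
    have e2 : Rq * P ^ 2 * P = (P * Rq) * (P * P) := by ring
    rw [e1, e2, key]
    have hA0 : 0 ≤ (1 - q) * T0 * Dq := mul_nonneg (mul_nonneg h1q hT00) hDq0
    have h3 : Dq * P ≤ P * P := mul_le_mul_of_nonneg_right hDqP hP
    have h4 : (1 - q) * T0 * Dq * (Dq * P) ≤ (1 - q) * T0 * Dq * (P * P) :=
      mul_le_mul_of_nonneg_left h3 hA0
    have hqS : 0 ≤ q * S := mul_nonneg hq0 hS0
    have h5 : (1 - q) * T0 * Dq * (P * P) ≤ ((1 - q) * T0 * Dq + q * S) * (P * P) :=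
      mul_le_mul_of_nonneg_right (by linarith) (mul_nonneg hP hP)
    exact h4.trans h5
  -- assemble
  simp only [hq] at hmain ⊢
  rw [hR0]
  have h0 : P - 0 * bL - 0 * bH = P := by ring
  rw [h0]
  exact hmain

end B

end PendantEdm

end Summit.Ventures.PercRepro2
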